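import Literature.NumberTheory.Automorphic.TorusCharacterLocalComponents
import Literature.NumberTheory.Automorphic.QuadraticIdelicNormLocalNorms
import Literature.NumberTheory.Automorphic.IdeleClassCharacterHecke
import HarnessLib

/-!
# [Liu2021, Def. 4.1] The SEMI-LOCAL component of a conjugate self-dual idele class character: `μ_v(u) · μ_v(ū) = 1` on `(L ⊗_{L⁺} L⁺_v)ˣ`,
# hence `μ_v ∘ (c ⊗ 1) = μ_v⁻¹`, at EVERY finite place `v` of `L⁺` (split or not)

Topic `NumberTheory/Automorphic`; namespace `Literature.NumberTheory.Automorphic` (by directory).  THEOREMS ONLY (no `def`, no instance, no notation,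
no named fact, no `sorry`).  For a CM field `L` with complex conjugation `c` and maximal real subfield `L⁺`, an idele class character `μ : C_L → S¹`
which is CONJUGATE SELF-DUAL in the sense of [Liu2021, Def. 4.1] («`μ(y ȳ) = 1`», ★ `IsConjugateSelfDual`, ★ `isConjugateSelfDual_iff_mul_conj`) — in
particular every CONJUGATE SYMPLECTIC `μ` (★ `IsConjugateSymplectic.isConjugateSelfDual`) — has semi-local components (★ `HeckeCharacter.semilocalComponent`
of ★ `toHeckeCharacter μ`, the `μ`-slot `(∏_{w ∣ v} L_w)ˣ →* ℂˣ` of ★ `cmXiTorusChar`) satisfying `μ_v(u) · μ_v((c ⊗ 1) u) = 1` for EVERY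
`u ∈ (∏_{w ∣ v} L_w)ˣ` (`(c ⊗ 1) = ` ★ `conjLocal L c v`): the printed identity at the semi-local idele `semilocalUnits v u`, whose conjugate is
`semilocalUnits v ((c ⊗ 1) u)` (★ `smul_semilocalUnits`).  The LOCAL-component form at a `c`-fixed place is ★
`Liu2021.LemD1IndexedNonVacuityPlaceDichotomy.localComponent_mul_localComponent_conj_eq_one`; this file is its semi-local twin, needed in the
`(LocalRing L v)ˣ`-currency of the principal series of `U(Φ₃)(L⁺_v)` (★ `cmPrincipalSeries` ∕ ★ `cmXiTorusChar`: the Weyl conjugate of the torus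
character `d(α,β,ᾱ⁻¹) ↦ μ_v(α)…` reads `μ_v(ᾱ)⁻¹ = μ_v(α)`).  Cell `hodgecm-mathlib` FLOOR 0, line `Cruxes/H413/Lines/F0_P2GR91NJacquet.lean`, stub K1,
sub-stub K1w consumer lemma (K1 lead B-p18 (g27) 2026-08-31T14:53:21Z).  HC_CM is proved only modulo the 2 remaining named inputs (hLiu418, h413) —
behind them the booked printed statements + the MOD package — until rung 0 closes; this file discharges none of them.

## References
* [Liu2021] Y. Liu, *Fourier–Jacobi cycles and arithmetic relative trace formula*, Camb. J. Math. 9 (2021) = arXiv:2102.11518, Def. 4.1 and Remark 4.2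
  (l. 1900–1905).
* [CasselsFrohlichANT1967] J. W. S. Cassels, A. Fröhlich (eds.), *Algebraic Number Theory* (1967), Ch. VII (Tate) §1.1, §4.
-/

set_option autoImplicit false

noncomputable section

open NumberField IsDedekindDomain
open Literature.NumberTheory.GaloisRepresentations (HeckeCharacter)
open Literature.NumberTheory.Automorphic.IdeleClassGroup (toHeckeCharacter IsConjugateSymplectic IsConjugateSelfDual isConjugateSelfDual_iff_mul_conj)

namespace Literature.NumberTheory.Automorphic

namespace UnitaryGroup

variable (L : Type) [Field L] [NumberField L] [IsCMField L]

/-- **`μ_v(u) · μ_v(ū) = 1`** — for a conjugate self-dual `μ : C_L → S¹` ([Liu2021, Def. 4.1]: `μ(y ȳ) = 1`), every finite place `v` of `L⁺` and every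
`u ∈ (∏_{w ∣ v} L_w)ˣ`, the semi-local component of `toHeckeCharacter μ` satisfies `μ_v(u) · μ_v((c ⊗ 1) u) = 1` (the printed identity at the semi-local idele
`y = semilocalUnits v u`, with `ȳ = c • y = semilocalUnits v ((c ⊗ 1) u)` by ★ `smul_semilocalUnits`). [cite: Liu2021, Def. 4.1 and Remark 4.2 (l. 1900–1905)] -/
theorem semilocalComponent_mul_semilocalComponent_conjLocal_eq_one (μ : IdeleClassGroup L →ₜ* Circle) (hμ : IsConjugateSelfDual L μ)
    (v : HeightOneSpectrum (𝓞 ↥(maximalRealSubfield L))) (u : (LocalRing L v)ˣ) :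
    (toHeckeCharacter L μ).semilocalComponent L v u *
        (toHeckeCharacter L μ).semilocalComponent L v
          (Units.map (conjLocal L (IsCMField.complexConj L) v : LocalRing L v →* LocalRing L v) u) = 1 := by
  have h := (isConjugateSelfDual_iff_mul_conj μ).1 hμ (semilocalUnits L v u)
  rw [smul_semilocalUnits L (IsCMField.complexConj L) u] at h
  apply Units.ext
  rw [semilocalComponent_apply, semilocalComponent_apply, ← map_mul, Units.val_one]
  have h' : (((toHeckeCharacter L μ) (semilocalUnits L v u *
      semilocalUnits L v (Units.map (conjLocal L (IsCMField.complexConj L) v : LocalRing L v →* LocalRing L v) u)) : ℂˣ) : ℂ) = 1 := by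
    rw [IdeleClassGroup.coe_toHeckeCharacter_apply, h, Circle.coe_one]
  exact h'

/-- **`μ_v(ū) = μ_v(u)⁻¹`** (the same, solved). [cite: Liu2021, Def. 4.1 (l. 1900–1902)] -/
theorem semilocalComponent_conjLocal_eq_inv (μ : IdeleClassGroup L →ₜ* Circle) (hμ : IsConjugateSelfDual L μ)
    (v : HeightOneSpectrum (𝓞 ↥(maximalRealSubfield L))) (u : (LocalRing L v)ˣ) :
    (toHeckeCharacter L μ).semilocalComponent L v
        (Units.map (conjLocal L (IsCMField.complexConj L) v : LocalRing L v →* LocalRing L v) u) =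
      ((toHeckeCharacter L μ).semilocalComponent L v u)⁻¹ :=
  eq_inv_of_mul_eq_one_right (semilocalComponent_mul_semilocalComponent_conjLocal_eq_one L μ hμ v u)

/-- **`μ_v(ū)⁻¹ = μ_v(u)`** — the form in which the Weyl conjugate `d(α,β,ᾱ⁻¹) ↦ d(ᾱ⁻¹,β,α)` of the torus character of ★ `cmXiTorusChar` is read.
[cite: Liu2021, Def. 4.1 (l. 1900–1902)] -/
theorem semilocalComponent_conjLocal_inv (μ : IdeleClassGroup L →ₜ* Circle) (hμ : IsConjugateSelfDual L μ)
    (v : HeightOneSpectrum (𝓞 ↥(maximalRealSubfield L))) (u : (LocalRing L v)ˣ) :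
    ((toHeckeCharacter L μ).semilocalComponent L v
        (Units.map (conjLocal L (IsCMField.complexConj L) v : LocalRing L v →* LocalRing L v) u))⁻¹ =
      (toHeckeCharacter L μ).semilocalComponent L v u := by
  rw [semilocalComponent_conjLocal_eq_inv L μ hμ v u, inv_inv]

/-- **As homomorphisms: `μ_v ∘ (c ⊗ 1) = μ_v⁻¹`** on `(∏_{w ∣ v} L_w)ˣ`. [cite: Liu2021, Def. 4.1 (l. 1900–1902)] -/
theorem semilocalComponent_comp_conjLocal (μ : IdeleClassGroup L →ₜ* Circle) (hμ : IsConjugateSelfDual L μ)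
    (v : HeightOneSpectrum (𝓞 ↥(maximalRealSubfield L))) :
    ((toHeckeCharacter L μ).semilocalComponent L v).comp
        (Units.map (conjLocal L (IsCMField.complexConj L) v : LocalRing L v →* LocalRing L v)) =
      ((toHeckeCharacter L μ).semilocalComponent L v)⁻¹ :=
  MonoidHom.ext fun u => by
    rw [MonoidHom.comp_apply, MonoidHom.inv_apply]
    exact semilocalComponent_conjLocal_eq_inv L μ hμ v u

/-- **Conjugate SYMPLECTIC case** ([Liu2021, Def. 4.1]: `μ|_{𝔸_{L⁺}^×} = ε_{L/L⁺}`; ★ `IsConjugateSymplectic.isConjugateSelfDual`): `μ_v(u) · μ_v(ū) = 1`.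
[cite: Liu2021, Def. 4.1 and Remark 4.2 (l. 1900–1905)] -/
theorem semilocalComponent_mul_semilocalComponent_conjLocal_eq_one_of_isConjugateSymplectic {μ : IdeleClassGroup L →ₜ* Circle}
    (hμ : IsConjugateSymplectic L μ) (v : HeightOneSpectrum (𝓞 ↥(maximalRealSubfield L))) (u : (LocalRing L v)ˣ) :
    (toHeckeCharacter L μ).semilocalComponent L v u *
        (toHeckeCharacter L μ).semilocalComponent L v
          (Units.map (conjLocal L (IsCMField.complexConj L) v : LocalRing L v →* LocalRing L v) u) = 1 :=
  semilocalComponent_mul_semilocalComponent_conjLocal_eq_one L μ hμ.isConjugateSelfDual v u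

/-- Conjugate symplectic case: **`μ_v(ū)⁻¹ = μ_v(u)`**. [cite: Liu2021, Def. 4.1 (l. 1900–1902)] -/
theorem semilocalComponent_conjLocal_inv_of_isConjugateSymplectic {μ : IdeleClassGroup L →ₜ* Circle}
    (hμ : IsConjugateSymplectic L μ) (v : HeightOneSpectrum (𝓞 ↥(maximalRealSubfield L))) (u : (LocalRing L v)ˣ) :
    ((toHeckeCharacter L μ).semilocalComponent L v
        (Units.map (conjLocal L (IsCMField.complexConj L) v : LocalRing L v →* LocalRing L v) u))⁻¹ =
      (toHeckeCharacter L μ).semilocalComponent L v u :=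
  semilocalComponent_conjLocal_inv L μ hμ.isConjugateSelfDual v u

/-- Conjugate symplectic case, as homomorphisms: **`μ_v ∘ (c ⊗ 1) = μ_v⁻¹`**. [cite: Liu2021, Def. 4.1 (l. 1900–1902)] -/
theorem semilocalComponent_comp_conjLocal_of_isConjugateSymplectic {μ : IdeleClassGroup L →ₜ* Circle}
    (hμ : IsConjugateSymplectic L μ) (v : HeightOneSpectrum (𝓞 ↥(maximalRealSubfield L))) :
    ((toHeckeCharacter L μ).semilocalComponent L v).comp
        (Units.map (conjLocal L (IsCMField.complexConj L) v : LocalRing L v →* LocalRing L v)) =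
      ((toHeckeCharacter L μ).semilocalComponent L v)⁻¹ :=
  semilocalComponent_comp_conjLocal L μ hμ.isConjugateSelfDual v

end UnitaryGroup

end Literature.NumberTheory.Automorphic

end
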